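/-
Copyright (c) 2026 the pub-hodgecm-mathlib formalisation cell (harness21).  Prover seat hodgecm-mathlib-LH7-p04 (g13): line LH7 hand on the LH4 dyadic chain (D-UNR),
brick (P-L)-dy «LEVI ROW 2-FREE», FILE L1 «THE SHEARED HEISENBERG CHART»; 2026-09-03.
-/
import Literature.NumberTheory.Automorphic.HeisenbergChartAtNonsplitPlace      -- ★ FILE A (F0P3a-p04 (g16)): `rank_redMat_map_heisElt_sub_one_eq_two`, `redMat_map_heisElt_sub_one_pow_three`, `isUnit_two_localRing`, `valued_conjLocal_apply_of_smul_eq`; brings ★ chart `HeisRing.heisHomeomorph`, ★ L-α2a, ★ L-α1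
import Literature.NumberTheory.LocalFields.UnramifiedQuadraticUnitTrace         -- ★ (B-p04 (g47)): `exists_v_eq_one_v_add_galAdicCompletionMap_eq_one` (a unit of unit trace at an inert-unramified place, ANY residue characteristic)
import Literature.NumberTheory.Automorphic.UnitaryGroupInertPlaceHyperbolicBasis  -- ★ `galAdicCompletionMap_galAdicCompletionMap_of_smul_eq` (`σ_w ∘ σ_w = id`)
import HarnessLib

/-!
# The SHEARED Heisenberg chart of `N ≤ U(Φ₃)(L⁺_v)` at a non-split place of ANY residue characteristic: integral points and residual rank strata

Topic `NumberTheory/Automorphic`; namespace `Literature.NumberTheory.Automorphic.UnitaryGroup` (generic §1 in `….UnitaryGroup.HeisRing`).  KERNEL MATHEMATICS ONLY: theorems,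
no definition, no named fact, no `sorry`, no instance, no notation.  Cell `pub/hodgecm-mathlib` (D-0151), crux H413 = `stmt-HodgeConjecture-24833`, half A line LH4 (dyadic pay-down of
`stub_N6nsDyadic`, organ (D-UNR) `stub_DyUnramCore`), brick **(P-L)-dy «THE LEVI ROW 2-FREE»**, FILE L1 (seat LH7-p04 (g13); consumers FILE L2 `HeisenbergStrataMeasureUnramifiedAll`
(strata volumes + the rank-piece integral through the shear), then the `h2`-free twins of ★ (O2) `classOrbitalIntegral_eq_mul_rankStrata_of_torus_deep` and ★ (P-3)
`depthZeroKappaTransfer_hyperspecial_levi`).  HONEST LABEL: HC_CM is proved only modulo the 7 printed citations (2 remaining named inputs: hLiu418 = stmt-HodgeConjecture-24832,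
h413 = stmt-HodgeConjecture-24833) until rung 0 closes; this file is count-neutral and discharges nothing.

THE MATHEMATICS ([Rogawski1990] §1.10 p. 9, §4.9 p. 54; [Flicker1998UnitaryFL] §2).  `L` CM, `v` a finite place of `L⁺` NON-SPLIT in `L` (`w ∣ v`, `c_L • w = w`),
`R = L ⊗ L⁺_v`, `σ = c_L ⊗ 1`, `N = unipotentU σ Φ₃`, `K₃ = U(Φ₃)(𝒪_v)`.  The chart ★ `HeisRing.heisElt x y = u(x, z)`, `z = y − ½·x·σx` (`y ∈ R⁻` skew) EXISTS at every place
(`2 ∈ R^×`: `R` has characteristic `0`), but ★ FILE A reads the integral points and the residual rank strata of `N ∩ K₃` in the coordinate `y` — `u ∈ K₃ ⟺ |x_w|, |y_w| ≤ 1` —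
which needs `|½|_w = 1`, false when `v ∣ 2`.  Here the SAME strata are read 2-FREE:
* §1 (generic valued field `K`, isometric `σ`) in the `z`-coordinate itself — `rank(red u(x,z) − 1) = 1` iff `|x| < 1 = |z|`, `= 0` iff `|x|, |z| < 1` (★ L-α1 on the entries
  `(x, z, −σx)`; rank `2` iff `|x| = 1` is ★ L-α2a, already 2-free) — and the perturbation lemmas `|z + c·x·σx| ≤ 1 ⟺ |z| ≤ 1` (`|x| ≤ 1`), `|z + c·x·σx| = 1 ⟺ |z| = 1` and
  `< 1 ⟺ < 1` (`|x| < 1`) for ANY `|c| ≤ 1`;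
* §2 (the CM place) the SHEAR CONSTANT: at a non-split place UNRAMIFIED in `L` there is `c ∈ R` with **`σc + c = 1` and `|c_w| ≤ 1`** (`c_w = ω ∕ (ω + σ_w ω)` for the unit of
  unit trace `ω` of ★ `UnramifiedQuadraticUnitTrace`, any residue characteristic; at `v ∤ 2` one may take `c = ½`), for which `(c − ½)·x·σx ∈ R⁻`, so that
  `y′ := y + (c − ½)·x·σx = z + c·x·σx` is again a skew coordinate; and the READINGS **`u(x, z) ∈ K₃ ⟺ |x_w| ≤ 1 ∧ |y′_w| ≤ 1`**, **rank `2 ∕ 1 ∕ 0` ⟺ `|x_w| = 1` ∕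
  `|x_w| < 1 = |y′_w|` ∕ `|x_w|, |y′_w| < 1`** — i.e. in the sheared coordinates `(x, y′)` the strata of `N ∩ K₃` are the products `𝒪 × 𝒪⁻`, `𝒪^× × 𝒪⁻`,
  `𝔪 × (𝒪⁻ ∖ 𝔪⁻)`, `𝔪 × 𝔪⁻` exactly as in ★ FILE A, at EVERY non-split unramified place.  FILE L2 pushes `μ_R ⊗ μ_{R⁻}` through the measure-preserving shear
  `(x, y) ↦ (x, y′)` (Mathlib `MeasurePreserving.skew_product`, as ★ `measurePreserving_heis_mul`) and recovers the volumes `(1 − q⁻², q⁻²(1 − q⁻¹), q⁻³)·μ_N(N ∩ K₃)`.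

## References
* [Rogawski1990] J. D. Rogawski, *Automorphic Representations of Unitary Groups in Three Variables*, Ann. of Math. Stud. 123 (1990), §1.10 p. 9; §4.9 p. 54.
* [Flicker1998UnitaryFL] Y. Z. Flicker, *Elementary proof of the fundamental lemma for a unitary group*, Canad. J. Math. 50 (1998), §2.
* [Serre1979] J.-P. Serre, *Local Fields*, GTM 67 (1979), Ch. V §2 (the trace of an unramified extension is onto).
-/

set_option autoImplicit false

noncomputable section

open IsDedekindDomain NumberField Matrix ValuativeRel
open scoped NumberField MatrixGroups Matrix

/-! ## §1 Generic: the `z`-reading of the strata and perturbation by `c·x·σx`, `|c| ≤ 1` -/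

namespace Literature.NumberTheory.Automorphic.UnitaryGroup.HeisRing

open Literature.NumberTheory.Automorphic Literature.NumberTheory.Automorphic.IntegralReduction

variable {K : Type*} [Field K] [ValuativeRel K] (σ : K →+* K) (hσv : ∀ x, valuation K (σ x) = valuation K x)

include hσv in
/-- `|c·x·σx| ≤ |x|·|x|` for `|c| ≤ 1` (`σ` isometric). [cite: Rogawski1990, §1.10 p. 9] -/
theorem valuation_mul_mul_map_le {c : K} (hc : valuation K c ≤ 1) (x : K) : valuation K (c * (x * σ x)) ≤ valuation K x * valuation K x := by
  rw [Valuation.map_mul, Valuation.map_mul, hσv]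
  calc valuation K c * (valuation K x * valuation K x) ≤ 1 * (valuation K x * valuation K x) := mul_le_mul' hc le_rfl
    _ = valuation K x * valuation K x := one_mul _

include hσv in
/-- **PERTURBATION, integral `x`**: `|z + c·x·σx| ≤ 1 ⟺ |z| ≤ 1` for `|x| ≤ 1`, `|c| ≤ 1`. [cite: Rogawski1990, §1.10 p. 9] -/
theorem valuation_add_mul_le_one_iff {c : K} (hc : valuation K c ≤ 1) {x : K} (hx : valuation K x ≤ 1) (z : K) :
    valuation K (z + c * (x * σ x)) ≤ 1 ↔ valuation K z ≤ 1 := by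
  have hd : valuation K (c * (x * σ x)) ≤ 1 :=
    (valuation_mul_mul_map_le σ hσv hc x).trans (by simpa only [mul_one] using mul_le_mul' hx hx)
  constructor
  · intro h
    have h' := Valuation.map_sub (valuation K) (z + c * (x * σ x)) (c * (x * σ x))
    rw [add_sub_cancel_right] at h'
    exact h'.trans (max_le h hd)
  · intro hz
    exact (Valuation.map_add (valuation K) z _).trans (max_le hz hd)

include hσv in
/-- **PERTURBATION, deep `x`**: `|z + c·x·σx| = 1 ⟺ |z| = 1` for `|x| < 1`, `|c| ≤ 1` (the perturbation lies in `𝔪`). [cite: Rogawski1990, §1.10 p. 9] -/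
theorem valuation_add_mul_eq_one_iff {c : K} (hc : valuation K c ≤ 1) {x : K} (hx : valuation K x < 1) (z : K) :
    valuation K (z + c * (x * σ x)) = 1 ↔ valuation K z = 1 := by
  have hd : valuation K (c * (x * σ x)) < 1 :=
    lt_of_le_of_lt (valuation_mul_mul_map_le σ hσv hc x)
      (by calc valuation K x * valuation K x ≤ valuation K x * 1 := mul_le_mul' le_rfl hx.le
            _ = valuation K x := mul_one _
            _ < 1 := hx)
  constructor
  · intro h
    have hlt : valuation K (-(c * (x * σ x))) < valuation K (z + c * (x * σ x)) := by rw [Valuation.map_neg, h]; exact hd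
    have h' := Valuation.map_add_eq_of_lt_left (valuation K) hlt
    rw [show z + c * (x * σ x) + -(c * (x * σ x)) = z by ring] at h'
    rw [h', h]
  · intro hz
    have hlt : valuation K (c * (x * σ x)) < valuation K z := by rw [hz]; exact hd
    rw [Valuation.map_add_eq_of_lt_left (valuation K) hlt, hz]

include hσv in
/-- **PERTURBATION, deep `x`**: `|z + c·x·σx| < 1 ⟺ |z| < 1` for `|x| < 1`, `|c| ≤ 1`. [cite: Rogawski1990, §1.10 p. 9] -/
theorem valuation_add_mul_lt_one_iff {c : K} (hc : valuation K c ≤ 1) {x : K} (hx : valuation K x < 1) (z : K) :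
    valuation K (z + c * (x * σ x)) < 1 ↔ valuation K z < 1 := by
  have hd : valuation K (c * (x * σ x)) < 1 :=
    lt_of_le_of_lt (valuation_mul_mul_map_le σ hσv hc x)
      (by calc valuation K x * valuation K x ≤ valuation K x * 1 := mul_le_mul' le_rfl hx.le
            _ = valuation K x := mul_one _
            _ < 1 := hx)
  constructor
  · intro h
    have h' := Valuation.map_sub (valuation K) (z + c * (x * σ x)) (c * (x * σ x))
    rw [add_sub_cancel_right] at h'
    exact lt_of_le_of_lt h' (max_lt h hd)
  · intro hz
    exact lt_of_le_of_lt (Valuation.map_add (valuation K) z _) (max_lt hz hd)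

variable [Invertible (2 : K)]

include hσv in
/-- **RANK 1 STRATUM, `z`-READING (2-free)**: `|x| < 1`, `|z| = 1` ⇒ `rank(red(heisMatrix σ x y) − 1) = 1`, `z = heisZ σ x y` (★ L-α1 on the entries `(x, z, −σx)`).
[cite: Rogawski1990, §4.9 p. 54] [cite: Flicker1998UnitaryFL, §2] -/
theorem rank_redMat_heisMatrix_sub_one_eq_one_of_heisZ {x y : K} (hx : valuation K x < 1) (hz : valuation K (heisZ σ x y) = 1) :
    (redMat (heisMatrix σ x y) - 1).rank = 1 := by
  unfold heisMatrix
  exact rank_redMat_unitriangular_sub_one_eq_one hx hz (by rw [valuation_neg_map_eq σ hσv]; exact hx)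

include hσv in
/-- **RANK 0 STRATUM, `z`-READING (2-free)**: `|x| < 1`, `|z| < 1` ⇒ `rank(red(heisMatrix σ x y) − 1) = 0`, `z = heisZ σ x y`. [cite: Rogawski1990, §4.9 p. 54]
[cite: Flicker1998UnitaryFL, §2] -/
theorem rank_redMat_heisMatrix_sub_one_eq_zero_of_heisZ {x y : K} (hx : valuation K x < 1) (hz : valuation K (heisZ σ x y) < 1) :
    (redMat (heisMatrix σ x y) - 1).rank = 0 := by
  unfold heisMatrix
  exact rank_redMat_unitriangular_sub_one_eq_zero hx hz (by rw [valuation_neg_map_eq σ hσv]; exact hx)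

end Literature.NumberTheory.Automorphic.UnitaryGroup.HeisRing

namespace Literature.NumberTheory.Automorphic.UnitaryGroup.HeisRing

/-- **THE SHEARED COORDINATE IS `z + c·x·σx`**: `y + (c − ½)·x·σx = heisZ σ x y + c·x·σx` (pure algebra, any commutative ring with `½`). [cite: Rogawski1990, §1.10 p. 9] -/
theorem add_sub_invOf_two_mul_eq_heisZ_add {R : Type*} [CommRing R] (σ : R →+* R) [Invertible (2 : R)] (c x y : R) :
    y + (c - ⅟(2 : R)) * (x * σ x) = heisZ σ x y + c * (x * σ x) := by
  unfold heisZ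
  ring

end Literature.NumberTheory.Automorphic.UnitaryGroup.HeisRing

/-! ## §2 The CM place: the shear constant and the sheared readings -/

namespace Literature.NumberTheory.Automorphic.UnitaryGroup

open Literature.NumberTheory.Automorphic Literature.NumberTheory.Automorphic.IntegralReduction

variable (L : Type) [Field L] [NumberField L] [IsCMField L] (v : HeightOneSpectrum (𝓞 ↥(maximalRealSubfield L)))
  (w : PlacesOver L v) (hw : IsCMField.complexConj L • w.1 = w.1)

/-- `(σ x)_w = σ_w x_w` at a non-split place (★ `conjLocal_apply_eq_of_smul_eq`, CM spelling). [cite: Rogawski1990, §1.9 p. 8] -/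
private theorem conjLocal_apply_w' (x : LocalRing L v) :
    conjLocal L (IsCMField.complexConj L) v x w = galAdicCompletionMap (L := L) (IsCMField.complexConj L) hw (x w) := by
  haveI : Algebra.IsQuadraticExtension ↥(maximalRealSubfield L) L := IsCMField.isQuadraticExtension L
  exact conjLocal_apply_eq_of_smul_eq (IsCMField.complexConj L) (IsCMField.complexConj_ne_one L) v w hw x

/-- `σ_w` is an isometry in the `ValuativeRel` currency. [cite: Rogawski1990, §1.9 p. 8] -/
private theorem valuation_galAdicCompletionMap' (z : w.1.adicCompletion L) :
    valuation (w.1.adicCompletion L) (galAdicCompletionMap (L := L) (IsCMField.complexConj L) hw z) = valuation (w.1.adicCompletion L) z :=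
  (v_eq_iff_valuation_eq _ _).1 (valued_galAdicCompletionMap L (IsCMField.complexConj L) hw z)

/-- The `w`-component of the matrix of `u(x, z)` is `heisMatrix σ_w x_w y_w` (re-derivation of ★ FILE A's private reading). [cite: Rogawski1990, §1.10 p. 9] -/
private theorem map_mat_heisElt_eq_heisMatrix' [Invertible (2 : LocalRing L v)] [Invertible (2 : w.1.adicCompletion L)]
    (hi : (⅟ (2 : LocalRing L v)) w = ⅟ (2 : w.1.adicCompletion L)) (x : LocalRing L v) (y : HeisRing.skewPart (conjLocal L (IsCMField.complexConj L) v)) :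
    ((HeisRing.heisElt (conjLocal L (IsCMField.complexConj L) v) (conjLocal_conjLocal_cm L v) (cmLocalForm_eq_over L 3 v) x y :
        ↥(unitaryGroupOfForm (conjLocal L (IsCMField.complexConj L) v) (cmLocalForm L 3 v))) : GL (Fin 3) (LocalRing L v)).val.map
        (Pi.evalRingHom (fun w' : PlacesOver L v => w'.1.adicCompletion L) w) =
      HeisRing.heisMatrix (galAdicCompletionMap (L := L) (IsCMField.complexConj L) hw) (x w) ((y : LocalRing L v) w) := by
  have hM : ((HeisRing.heisElt (conjLocal L (IsCMField.complexConj L) v) (conjLocal_conjLocal_cm L v) (cmLocalForm_eq_over L 3 v) x y :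
        ↥(unitaryGroupOfForm (conjLocal L (IsCMField.complexConj L) v) (cmLocalForm L 3 v))) : GL (Fin 3) (LocalRing L v)).val =
      HeisRing.heisMatrix (conjLocal L (IsCMField.complexConj L) v) x y := rfl
  have hz : (HeisRing.heisZ (conjLocal L (IsCMField.complexConj L) v) x (y : LocalRing L v)) w =
      HeisRing.heisZ (galAdicCompletionMap (L := L) (IsCMField.complexConj L) hw) (x w) ((y : LocalRing L v) w) := by
    simp only [HeisRing.heisZ, Pi.sub_apply, Pi.mul_apply, hi, conjLocal_apply_w' L v w hw]
  rw [hM]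
  ext i j
  fin_cases i <;> fin_cases j <;>
    simp [HeisRing.heisMatrix, Matrix.map_apply, hz, conjLocal_apply_w' L v w hw]

/-- The `z`-entry read at `w`: `(heisZ σ x y)_w = heisZ σ_w x_w y_w`. [cite: Rogawski1990, §1.10 p. 9] -/
private theorem heisZ_apply_w [Invertible (2 : LocalRing L v)] [Invertible (2 : w.1.adicCompletion L)]
    (hi : (⅟ (2 : LocalRing L v)) w = ⅟ (2 : w.1.adicCompletion L)) (x y : LocalRing L v) :
    (HeisRing.heisZ (conjLocal L (IsCMField.complexConj L) v) x y) w =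
      HeisRing.heisZ (galAdicCompletionMap (L := L) (IsCMField.complexConj L) hw) (x w) (y w) := by
  simp only [HeisRing.heisZ, Pi.sub_apply, Pi.mul_apply, hi, conjLocal_apply_w' L v w hw]

/-! ### §2.1 The shear constant -/

include hw in
/-- **THE SHEAR CONSTANT**: at a non-split place `v` UNRAMIFIED in `L` (any residue characteristic) there is `c ∈ R = L ⊗ L⁺_v` with **`σ c + c = 1`** and **`|c_w| ≤ 1`**:
`c_w = ω ∕ (ω + σ_w ω)` for a unit `ω` of unit trace (★ `exists_v_eq_one_v_add_galAdicCompletionMap_eq_one`: the residue extension of the unramified `L_w ∕ L⁺_v` is separable, so its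
trace is onto).  At `v ∤ 2` the constant `½` also qualifies; the point is that `c` exists at `v ∣ 2` too. [cite: Serre1979, Ch. V §2] [cite: Rogawski1990, §1.10 p. 9] -/
theorem exists_conjLocal_add_self_eq_one (hv : Algebra.IsUnramifiedIn (𝓞 L) v.asIdeal) :
    ∃ c : LocalRing L v, conjLocal L (IsCMField.complexConj L) v c + c = 1 ∧ Valued.v (c w) ≤ 1 := by
  haveI : Algebra.IsQuadraticExtension ↥(maximalRealSubfield L) L := IsCMField.isQuadraticExtension L
  have hc1 : IsCMField.complexConj L ≠ 1 := IsCMField.complexConj_ne_one L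
  haveI : Subsingleton (PlacesOver L v) := PlacesOver.subsingleton_of_smul_eq (IsCMField.complexConj L) hc1 w hw
  letI : Unique (PlacesOver L v) := uniqueOfSubsingleton w
  obtain ⟨ω, hω, hωtr⟩ := Literature.NumberTheory.LocalFields.UnramifiedQuadraticNorm.exists_v_eq_one_v_add_galAdicCompletionMap_eq_one L v w hw hv
  have hs0 : ω + galAdicCompletionMap (L := L) (IsCMField.complexConj L) hw ω ≠ 0 := fun h => by
    rw [h, map_zero] at hωtr; exact zero_ne_one hωtr
  have hσs : galAdicCompletionMap (L := L) (IsCMField.complexConj L) hw (ω + galAdicCompletionMap (L := L) (IsCMField.complexConj L) hw ω) =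
      ω + galAdicCompletionMap (L := L) (IsCMField.complexConj L) hw ω := by
    rw [map_add, galAdicCompletionMap_galAdicCompletionMap_of_smul_eq (IsCMField.complexConj L) w hc1 hw, add_comm]
  let π : LocalRing L v ≃+* w.1.adicCompletion L := RingEquiv.piUnique fun w' : PlacesOver L v => w'.1.adicCompletion L
  have hπ : ∀ x : LocalRing L v, π x = x w := fun _ => rfl
  have hπs : ∀ y : w.1.adicCompletion L, (π.symm y) w = y := fun y => by
    have h := π.apply_symm_apply y
    rwa [hπ] at h
  refine ⟨π.symm (ω / (ω + galAdicCompletionMap (L := L) (IsCMField.complexConj L) hw ω)), ?_, ?_⟩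
  · funext w'
    obtain rfl : w' = w := Subsingleton.elim _ _
    rw [Pi.add_apply, Pi.one_apply, conjLocal_apply_w' L v w' hw, hπs, map_div₀, hσs, ← add_div, add_comm, div_self hs0]
  · rw [hπs, map_div₀, hω, hωtr, div_one]

/-- **`(c − ½)·x·σx ∈ R⁻`** when `σ c + c = 1`: `σ((c − ½)·x·σx) = (σc − ½)·σx·x = (½ − c)·x·σx`. [cite: Rogawski1990, §1.10 p. 9] -/
theorem sub_invOf_two_mul_mem_skewPart [Invertible (2 : LocalRing L v)] {c : LocalRing L v} (hc : conjLocal L (IsCMField.complexConj L) v c + c = 1) (x : LocalRing L v) :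
    (c - ⅟(2 : LocalRing L v)) * (x * conjLocal L (IsCMField.complexConj L) v x) ∈ HeisRing.skewPart (conjLocal L (IsCMField.complexConj L) v) := by
  rw [HeisRing.mem_skewPart_iff, map_mul, map_mul, map_sub, HeisRing.map_invOf_two, conjLocal_conjLocal_cm, eq_sub_of_add_eq hc]
  have h2 : (⅟(2 : LocalRing L v)) + ⅟(2 : LocalRing L v) = 1 := by rw [← two_mul, mul_invOf_self]
  linear_combination (-(conjLocal L (IsCMField.complexConj L) v x * x)) * h2

/-! ### §2.2 Integral points and rank strata in the `z`-reading (2-free) -/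

include hw in
/-- **INTEGRAL POINTS, `z`-READING: `u(x, z) ∈ K₃ ⟺ |x_w| ≤ 1 ∧ |z_w| ≤ 1`** (`z = heisZ σ x y`; any residue characteristic): `K₃`-membership is integrality of the entries
`1, 0, ±x, ±σx, z, σz` of `u` and `u⁻¹` at the unique place `w` (★ `mem_cmLocalIntegralLevel_iff_forall_v_le_one`, `|σ·|_w = |·|_w`). [cite: Rogawski1990, §1.10 p. 9; §4.9 p. 54] -/
theorem heisElt_mem_cmLocalIntegralLevel_iff_heisZ [Invertible (2 : LocalRing L v)]
    (x : LocalRing L v) (y : HeisRing.skewPart (conjLocal L (IsCMField.complexConj L) v)) :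
    (HeisRing.heisElt (conjLocal L (IsCMField.complexConj L) v) (conjLocal_conjLocal_cm L v) (cmLocalForm_eq_over L 3 v) x y :
        ↥(unitaryGroupOfForm (conjLocal L (IsCMField.complexConj L) v) (cmLocalForm L 3 v))) ∈
        cmLocalIntegralLevel L 3 (Matrix.of fun i j : Fin 3 => if i.val + j.val + 1 = 3 then (1 : L) else 0) v ↔
      Valued.v (x w) ≤ 1 ∧ Valued.v ((HeisRing.heisZ (conjLocal L (IsCMField.complexConj L) v) x (y : LocalRing L v)) w) ≤ 1 := by
  haveI : Algebra.IsQuadraticExtension ↥(maximalRealSubfield L) L := IsCMField.isQuadraticExtension L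
  haveI : Subsingleton (PlacesOver L v) :=
    PlacesOver.subsingleton_of_smul_eq (IsCMField.complexConj L) (IsCMField.complexConj_ne_one L) w hw
  have hσv : ∀ r : LocalRing L v, Valued.v (conjLocal L (IsCMField.complexConj L) v r w) = Valued.v (r w) := valued_conjLocal_apply_of_smul_eq L v w hw
  rw [mem_cmLocalIntegralLevel_iff_forall_v_le_one]
  change ((∀ (i j : Fin 3) (w' : PlacesOver L v), Valued.v (HeisRing.heisMatrix (conjLocal L (IsCMField.complexConj L) v) x (y : LocalRing L v) i j w') ≤ 1) ∧
      ∀ (i j : Fin 3) (w' : PlacesOver L v), Valued.v (HeisRing.heisMatrixInv (conjLocal L (IsCMField.complexConj L) v) x (y : LocalRing L v) i j w') ≤ 1) ↔ _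
  constructor
  · rintro ⟨h, -⟩
    have h01 := h 0 1 w
    have h02 := h 0 2 w
    simp only [HeisRing.heisMatrix, Matrix.of_apply, Matrix.cons_val', Matrix.cons_val_zero, Matrix.cons_val_one, Matrix.cons_val_two,
      Matrix.empty_val', Matrix.cons_val_fin_one, Matrix.head_cons, Matrix.tail_cons] at h01 h02
    exact ⟨h01, h02⟩
  · rintro ⟨hx, hz⟩
    have hσx : Valued.v ((conjLocal L (IsCMField.complexConj L) v x) w) ≤ 1 := by rw [hσv]; exact hx
    have hσz : Valued.v ((conjLocal L (IsCMField.complexConj L) v (HeisRing.heisZ (conjLocal L (IsCMField.complexConj L) v) x (y : LocalRing L v))) w) ≤ 1 := by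
      rw [hσv]; exact hz
    refine ⟨fun i j w' => ?_, fun i j w' => ?_⟩ <;> obtain rfl : w' = w := Subsingleton.elim _ _ <;>
      fin_cases i <;> fin_cases j <;>
        simp [-conjLocal_apply, HeisRing.heisMatrix, HeisRing.heisMatrixInv, hx, hz, hσx, hσz]

include hw in
/-- **RANK 1 STRATUM, `z`-READING**: `|x_w| < 1`, `|z_w| = 1` ⇒ `rank(red(u(x,z)_w) − 1) = 1` (any residue characteristic). [cite: Rogawski1990, §4.9 p. 54] [cite: Flicker1998UnitaryFL, §2] -/
theorem rank_redMat_map_heisElt_sub_one_eq_one_of_heisZ [Invertible (2 : LocalRing L v)]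
    {x : LocalRing L v} {y : HeisRing.skewPart (conjLocal L (IsCMField.complexConj L) v)} (hx : Valued.v (x w) < 1)
    (hz : Valued.v ((HeisRing.heisZ (conjLocal L (IsCMField.complexConj L) v) x (y : LocalRing L v)) w) = 1) :
    (redMat (((HeisRing.heisElt (conjLocal L (IsCMField.complexConj L) v) (conjLocal_conjLocal_cm L v) (cmLocalForm_eq_over L 3 v) x y :
        ↥(unitaryGroupOfForm (conjLocal L (IsCMField.complexConj L) v) (cmLocalForm L 3 v))) : GL (Fin 3) (LocalRing L v)).val.map
        (Pi.evalRingHom (fun w' : PlacesOver L v => w'.1.adicCompletion L) w)) - 1).rank = 1 := by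
  letI : Invertible (2 : w.1.adicCompletion L) :=
    ⟨(⅟ (2 : LocalRing L v)) w, by simpa [Pi.mul_apply, Pi.ofNat_apply] using congrFun (invOf_mul_self (2 : LocalRing L v)) w,
      by simpa [Pi.mul_apply, Pi.ofNat_apply] using congrFun (mul_invOf_self (2 : LocalRing L v)) w⟩
  rw [map_mat_heisElt_eq_heisMatrix' L v w hw rfl x y]
  rw [heisZ_apply_w L v w hw rfl] at hz
  exact HeisRing.rank_redMat_heisMatrix_sub_one_eq_one_of_heisZ _ (valuation_galAdicCompletionMap' L v w hw)
    ((v_lt_one_iff_valuation_lt_one _).1 hx) ((v_eq_one_iff_valuation_eq_one _).1 hz)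

include hw in
/-- **RANK 0 STRATUM, `z`-READING**: `|x_w| < 1`, `|z_w| < 1` ⇒ `rank(red(u(x,z)_w) − 1) = 0` (any residue characteristic). [cite: Rogawski1990, §4.9 p. 54] [cite: Flicker1998UnitaryFL, §2] -/
theorem rank_redMat_map_heisElt_sub_one_eq_zero_of_heisZ [Invertible (2 : LocalRing L v)]
    {x : LocalRing L v} {y : HeisRing.skewPart (conjLocal L (IsCMField.complexConj L) v)} (hx : Valued.v (x w) < 1)
    (hz : Valued.v ((HeisRing.heisZ (conjLocal L (IsCMField.complexConj L) v) x (y : LocalRing L v)) w) < 1) :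
    (redMat (((HeisRing.heisElt (conjLocal L (IsCMField.complexConj L) v) (conjLocal_conjLocal_cm L v) (cmLocalForm_eq_over L 3 v) x y :
        ↥(unitaryGroupOfForm (conjLocal L (IsCMField.complexConj L) v) (cmLocalForm L 3 v))) : GL (Fin 3) (LocalRing L v)).val.map
        (Pi.evalRingHom (fun w' : PlacesOver L v => w'.1.adicCompletion L) w)) - 1).rank = 0 := by
  letI : Invertible (2 : w.1.adicCompletion L) :=
    ⟨(⅟ (2 : LocalRing L v)) w, by simpa [Pi.mul_apply, Pi.ofNat_apply] using congrFun (invOf_mul_self (2 : LocalRing L v)) w,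
      by simpa [Pi.mul_apply, Pi.ofNat_apply] using congrFun (mul_invOf_self (2 : LocalRing L v)) w⟩
  rw [map_mat_heisElt_eq_heisMatrix' L v w hw rfl x y]
  rw [heisZ_apply_w L v w hw rfl] at hz
  exact HeisRing.rank_redMat_heisMatrix_sub_one_eq_zero_of_heisZ _ (valuation_galAdicCompletionMap' L v w hw)
    ((v_lt_one_iff_valuation_lt_one _).1 hx) ((v_lt_one_iff_valuation_lt_one _).1 hz)

/-! ### §2.3 The sheared readings: `y′ = y + (c − ½)·x·σx = z + c·x·σx` -/

include hw in
/-- **INTEGRAL POINTS, SHEARED: `u(x, z) ∈ K₃ ⟺ |x_w| ≤ 1 ∧ |y′_w| ≤ 1`**, `y′ = y + (c − ½)·x·σx`, for ANY `c ∈ R` with `|c_w| ≤ 1` (no relation on `c` is needed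
for this reading; `σc + c = 1` is what makes `y′` skew). [cite: Rogawski1990, §1.10 p. 9; §4.9 p. 54] -/
theorem heisElt_mem_cmLocalIntegralLevel_iff_shear [Invertible (2 : LocalRing L v)] {c : LocalRing L v} (hcw : Valued.v (c w) ≤ 1)
    (x : LocalRing L v) (y : HeisRing.skewPart (conjLocal L (IsCMField.complexConj L) v)) :
    (HeisRing.heisElt (conjLocal L (IsCMField.complexConj L) v) (conjLocal_conjLocal_cm L v) (cmLocalForm_eq_over L 3 v) x y :
        ↥(unitaryGroupOfForm (conjLocal L (IsCMField.complexConj L) v) (cmLocalForm L 3 v))) ∈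
        cmLocalIntegralLevel L 3 (Matrix.of fun i j : Fin 3 => if i.val + j.val + 1 = 3 then (1 : L) else 0) v ↔
      Valued.v (x w) ≤ 1 ∧ Valued.v (((y : LocalRing L v) + (c - ⅟(2 : LocalRing L v)) * (x * conjLocal L (IsCMField.complexConj L) v x)) w) ≤ 1 := by
  letI : Invertible (2 : w.1.adicCompletion L) :=
    ⟨(⅟ (2 : LocalRing L v)) w, by simpa [Pi.mul_apply, Pi.ofNat_apply] using congrFun (invOf_mul_self (2 : LocalRing L v)) w,
      by simpa [Pi.mul_apply, Pi.ofNat_apply] using congrFun (mul_invOf_self (2 : LocalRing L v)) w⟩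
  rw [heisElt_mem_cmLocalIntegralLevel_iff_heisZ L v w hw, HeisRing.add_sub_invOf_two_mul_eq_heisZ_add (conjLocal L (IsCMField.complexConj L) v) c x (y : LocalRing L v), Pi.add_apply, heisZ_apply_w L v w hw rfl,
    Pi.mul_apply, Pi.mul_apply, conjLocal_apply_w' L v w hw]
  refine and_congr_right fun hx => ?_
  rw [v_le_one_iff_valuation_le_one, v_le_one_iff_valuation_le_one]
  exact (HeisRing.valuation_add_mul_le_one_iff _ (valuation_galAdicCompletionMap' L v w hw) ((v_le_one_iff_valuation_le_one _).1 hcw)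
    ((v_le_one_iff_valuation_le_one _).1 hx) _).symm

include hw in
/-- **RANK 1 STRATUM, SHEARED**: `|x_w| < 1`, `|y′_w| = 1` ⇒ `rank(red(u(x,z)_w) − 1) = 1` (`y′ = y + (c − ½)·x·σx`, `|c_w| ≤ 1`; any residue characteristic).
[cite: Rogawski1990, §4.9 p. 54] [cite: Flicker1998UnitaryFL, §2] -/
theorem rank_redMat_map_heisElt_sub_one_eq_one_of_shear [Invertible (2 : LocalRing L v)] {c : LocalRing L v} (hcw : Valued.v (c w) ≤ 1)
    {x : LocalRing L v} {y : HeisRing.skewPart (conjLocal L (IsCMField.complexConj L) v)} (hx : Valued.v (x w) < 1)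
    (hy : Valued.v (((y : LocalRing L v) + (c - ⅟(2 : LocalRing L v)) * (x * conjLocal L (IsCMField.complexConj L) v x)) w) = 1) :
    (redMat (((HeisRing.heisElt (conjLocal L (IsCMField.complexConj L) v) (conjLocal_conjLocal_cm L v) (cmLocalForm_eq_over L 3 v) x y :
        ↥(unitaryGroupOfForm (conjLocal L (IsCMField.complexConj L) v) (cmLocalForm L 3 v))) : GL (Fin 3) (LocalRing L v)).val.map
        (Pi.evalRingHom (fun w' : PlacesOver L v => w'.1.adicCompletion L) w)) - 1).rank = 1 := by
  letI : Invertible (2 : w.1.adicCompletion L) :=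
    ⟨(⅟ (2 : LocalRing L v)) w, by simpa [Pi.mul_apply, Pi.ofNat_apply] using congrFun (invOf_mul_self (2 : LocalRing L v)) w,
      by simpa [Pi.mul_apply, Pi.ofNat_apply] using congrFun (mul_invOf_self (2 : LocalRing L v)) w⟩
  refine rank_redMat_map_heisElt_sub_one_eq_one_of_heisZ L v w hw hx ?_
  rw [HeisRing.add_sub_invOf_two_mul_eq_heisZ_add (conjLocal L (IsCMField.complexConj L) v) c x (y : LocalRing L v), Pi.add_apply, heisZ_apply_w L v w hw rfl, Pi.mul_apply, Pi.mul_apply,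
    conjLocal_apply_w' L v w hw, v_eq_one_iff_valuation_eq_one,
    HeisRing.valuation_add_mul_eq_one_iff _ (valuation_galAdicCompletionMap' L v w hw) ((v_le_one_iff_valuation_le_one _).1 hcw)
      ((v_lt_one_iff_valuation_lt_one _).1 hx)] at hy
  rw [heisZ_apply_w L v w hw rfl]
  exact (v_eq_one_iff_valuation_eq_one _).2 hy

include hw in
/-- **RANK 0 STRATUM, SHEARED**: `|x_w| < 1`, `|y′_w| < 1` ⇒ `rank(red(u(x,z)_w) − 1) = 0` (`y′ = y + (c − ½)·x·σx`, `|c_w| ≤ 1`; any residue characteristic).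
[cite: Rogawski1990, §4.9 p. 54] [cite: Flicker1998UnitaryFL, §2] -/
theorem rank_redMat_map_heisElt_sub_one_eq_zero_of_shear [Invertible (2 : LocalRing L v)] {c : LocalRing L v} (hcw : Valued.v (c w) ≤ 1)
    {x : LocalRing L v} {y : HeisRing.skewPart (conjLocal L (IsCMField.complexConj L) v)} (hx : Valued.v (x w) < 1)
    (hy : Valued.v (((y : LocalRing L v) + (c - ⅟(2 : LocalRing L v)) * (x * conjLocal L (IsCMField.complexConj L) v x)) w) < 1) :
    (redMat (((HeisRing.heisElt (conjLocal L (IsCMField.complexConj L) v) (conjLocal_conjLocal_cm L v) (cmLocalForm_eq_over L 3 v) x y :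
        ↥(unitaryGroupOfForm (conjLocal L (IsCMField.complexConj L) v) (cmLocalForm L 3 v))) : GL (Fin 3) (LocalRing L v)).val.map
        (Pi.evalRingHom (fun w' : PlacesOver L v => w'.1.adicCompletion L) w)) - 1).rank = 0 := by
  letI : Invertible (2 : w.1.adicCompletion L) :=
    ⟨(⅟ (2 : LocalRing L v)) w, by simpa [Pi.mul_apply, Pi.ofNat_apply] using congrFun (invOf_mul_self (2 : LocalRing L v)) w,
      by simpa [Pi.mul_apply, Pi.ofNat_apply] using congrFun (mul_invOf_self (2 : LocalRing L v)) w⟩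
  refine rank_redMat_map_heisElt_sub_one_eq_zero_of_heisZ L v w hw hx ?_
  rw [HeisRing.add_sub_invOf_two_mul_eq_heisZ_add (conjLocal L (IsCMField.complexConj L) v) c x (y : LocalRing L v), Pi.add_apply, heisZ_apply_w L v w hw rfl, Pi.mul_apply, Pi.mul_apply,
    conjLocal_apply_w' L v w hw, v_lt_one_iff_valuation_lt_one,
    HeisRing.valuation_add_mul_lt_one_iff _ (valuation_galAdicCompletionMap' L v w hw) ((v_le_one_iff_valuation_le_one _).1 hcw)
      ((v_lt_one_iff_valuation_lt_one _).1 hx)] at hy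
  rw [heisZ_apply_w L v w hw rfl]
  exact (v_lt_one_iff_valuation_lt_one _).2 hy

include hw in
/-- **THE TRICHOTOMY ON `N ∩ K₃`, SHEARED** (any residue characteristic): for `u = u(x, z) ∈ K₃` the Jordan rank of `red(u_w) − 1` is `2`, `1` or `0` according as `|x_w| = 1`;
`|x_w| < 1 = |y′_w|`; `|x_w|, |y′_w| < 1`, and `(red(u_w) − 1)³ = 0` (★ FILE A). [cite: Rogawski1990, §4.9 p. 54] [cite: Flicker1998UnitaryFL, §2] -/
theorem rank_redMat_map_heisElt_sub_one_eq_ite_of_shear [Invertible (2 : LocalRing L v)] {c : LocalRing L v} (hcw : Valued.v (c w) ≤ 1)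
    {x : LocalRing L v} {y : HeisRing.skewPart (conjLocal L (IsCMField.complexConj L) v)} (hx : Valued.v (x w) ≤ 1)
    (hy : Valued.v (((y : LocalRing L v) + (c - ⅟(2 : LocalRing L v)) * (x * conjLocal L (IsCMField.complexConj L) v x)) w) ≤ 1)
    [Decidable (Valued.v (x w) = 1)] [Decidable (Valued.v (((y : LocalRing L v) + (c - ⅟(2 : LocalRing L v)) * (x * conjLocal L (IsCMField.complexConj L) v x)) w) = 1)] :
    (redMat (((HeisRing.heisElt (conjLocal L (IsCMField.complexConj L) v) (conjLocal_conjLocal_cm L v) (cmLocalForm_eq_over L 3 v) x y :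
        ↥(unitaryGroupOfForm (conjLocal L (IsCMField.complexConj L) v) (cmLocalForm L 3 v))) : GL (Fin 3) (LocalRing L v)).val.map
        (Pi.evalRingHom (fun w' : PlacesOver L v => w'.1.adicCompletion L) w)) - 1).rank =
      if Valued.v (x w) = 1 then 2 else if Valued.v (((y : LocalRing L v) + (c - ⅟(2 : LocalRing L v)) * (x * conjLocal L (IsCMField.complexConj L) v x)) w) = 1 then 1 else 0 := by
  by_cases hx1 : Valued.v (x w) = 1
  · rw [if_pos hx1]; exact rank_redMat_map_heisElt_sub_one_eq_two L v w hw hx1 y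
  · rw [if_neg hx1]
    have hxlt : Valued.v (x w) < 1 := lt_of_le_of_ne hx hx1
    by_cases hy1 : Valued.v (((y : LocalRing L v) + (c - ⅟(2 : LocalRing L v)) * (x * conjLocal L (IsCMField.complexConj L) v x)) w) = 1
    · rw [if_pos hy1]; exact rank_redMat_map_heisElt_sub_one_eq_one_of_shear L v w hw hcw hxlt hy1
    · rw [if_neg hy1]; exact rank_redMat_map_heisElt_sub_one_eq_zero_of_shear L v w hw hcw hxlt (lt_of_le_of_ne hy hy1)

end Literature.NumberTheory.Automorphic.UnitaryGroup

end
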